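import Literature.NumberTheory.EllipticCurves.CyclotomicLineWeilPairingProofs
import Literature.NumberTheory.EllipticCurves.TorsionCardinality
import HarnessLib

/-!
# The scalar of a root-of-unity-fixing automorphism on `E[p^k]/ℤP₀` (Weil pairing annihilator)

`Proofs` file (theorems only) in topic `NumberTheory/EllipticCurves`; companion of
`CyclotomicLineWeilPairingProofs` in the local input (brick B) of the elementary proof of
Greenberg's Lemma 3.4 at the layer `n = 0` (LNM 1716, p. 89). Let `P₀ ∈ E(K̄_E)` have order
`p^k`. The annihilator of `P₀` under the Weil pairing `e_{p^k}(·, P₀)` is exactly `ℤP₀`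
(`e(·, P₀)` is onto `μ_{p^k}`, so its kernel has `p^{2k}/p^k = p^k` elements and contains `ℤP₀`).
Consequently, if `σ ∈ Γ_E` fixes the `p^k`-th roots of unity and `σP₀ = bP₀`, then
`bσQ - Q ∈ ℤP₀` for every `Q ∈ E[p^k]` (`e(bσQ - Q, P₀) = e(σQ, σP₀)/e(Q, P₀) = σe(Q,P₀)/e(Q,P₀) = 1`):
`σ` acts on `E[p^k]/ℤP₀` by `b⁻¹` (`localPoints_exists_nsmul_smul_sub_eq_nsmul`). For an
ordinary prime and `σ` the arithmetic Frobenius fixing `μ_{p^∞}` this is Greenberg's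
`φ · ψ = χ` on the ordinary filtration read at `χ(σ) = 1` (LNM 1716, §2 p. 70).

## References

* [SilvermanAEC2009] J. H. Silverman, *AEC*, Prop. III.8.1, Cor. III.6.4(b).
* [GreenbergLNM1716] R. Greenberg, LNM 1716 (1999), §2 p. 70, §3 Lemma 3.4.
-/

noncomputable section

open scoped Classical

universe u

namespace WeierstrassCurve

open Literature.NumberTheory.EllipticCurves Field _root_.AddSubgroup

variable {K : Type u} [Field K] (W : WeierstrassCurve K) [W.IsElliptic]
  (E : Type u) [Field E] [Algebra K E] [CharZero E]

/-- **The scalar of a root-of-unity-fixing `σ` on `E[p^k]/ℤP₀` is `b⁻¹` when `σP₀ = bP₀`.**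
For `P₀ ∈ E(K̄_E)` of order `p^k`, `σ ∈ Γ_E` fixing every `p^k`-th root of unity of `K̄_E`, and
`σP₀ = bP₀`: every `p^k`-torsion point `Q` satisfies `b σQ - Q = dP₀` for some `d`. (Weil pairing
`e = e_{p^k}`: the annihilator of `P₀` under `e(·, P₀)` is `ℤP₀` by counting — `e(·, P₀)` is
onto `μ_{p^k}` since `p^{k-1}P₀ ≠ O`, `#E[p^k] = p^{2k}` — and
`e(bσQ - Q, P₀) = e(σQ, σP₀) e(Q, P₀)⁻¹ = σ(e(Q,P₀)) e(Q,P₀)⁻¹ = 1`.) Silverman, *AEC*,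
III.8.1; Greenberg, LNM 1716, §2 p. 70 (`φψ = χ`). [cite: SilvermanAEC2009, Prop. III.8.1] -/
theorem localPoints_exists_nsmul_smul_sub_eq_nsmul {p : ℕ} [hp : Fact p.Prime] {k : ℕ}
    {P₀ : localPoints W E} (hP₀ : addOrderOf P₀ = p ^ k)
    {σ : absoluteGaloisGroup E} (hσμ : ∀ ξ : AlgebraicClosure E, ξ ^ p ^ k = 1 → σ • ξ = ξ)
    {b : ℕ} (hσP₀ : σ • P₀ = b • P₀)
    (Q : localPoints W E) (hQ : ((p ^ k : ℕ) : ℤ) • Q = 0) :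
    ∃ d : ℕ, b • σ • Q - Q = d • P₀ := by
  rcases Nat.eq_zero_or_pos k with rfl | hk
  · -- `p^0 Q = 0`: `Q = 0`, and `P₀ = 0`
    rw [pow_zero, Nat.cast_one, one_smul] at hQ
    subst hQ
    exact ⟨0, by rw [smul_zero, smul_zero, sub_zero, zero_smul]⟩
  -- the Weil pairing on `(W ⊗ E)[p^k]`
  haveI : PerfectField E := PerfectField.ofCharZero
  have hm2 : 2 ≤ p ^ k := hp.out.two_le.trans (Nat.le_self_pow hk.ne' p)
  have hpk0 : p ^ k ≠ 0 := pow_ne_zero k hp.out.ne_zero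
  have hmE : ((p ^ k : ℕ) : E) ≠ 0 := by exact_mod_cast hpk0
  obtain ⟨e, hpow, haddl, haddr, hself, hnondeg, hgal⟩ :=
    exists_weilPairing_holds (W.baseChange E) (p ^ k) hm2 hmE
  -- transport `E(K̄_E) = (W ⊗ E)(K̄_E)`
  set T : localPoints W E ≃+ geomPoints (W.baseChange E) :=
    Affine.Point.congrEquiv (W.baseChange_baseChange_algebraicClosure_eq E).symm with hTdef
  have hT : ∀ (τ : absoluteGaloisGroup E) (P : localPoints W E), T (τ • P) = τ • T P := by
    intro τ P
    rcases P with _ | ⟨x, y, h⟩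
    · change T (τ • (0 : localPoints W E)) = τ • T 0
      rw [smul_zero, map_zero, smul_zero]
    · rw [localPoints.smul_def, Affine.Point.map_some]
      refine (Affine.Point.congrEquiv_some _ _).trans ?_
      refine Eq.trans ?_ (congrArg (fun R : geomPoints (W.baseChange E) ↦ τ • R)
        (Affine.Point.congrEquiv_some (W.baseChange_baseChange_algebraicClosure_eq E).symm h)).symm
      rfl
  -- torsion elements
  have hP₀tor : ((p ^ k : ℕ) : ℤ) • (T P₀) = 0 := by
    rw [← map_zsmul, natCast_zsmul, ← hP₀, addOrderOf_nsmul_eq_zero, map_zero]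
  set P₀' : geomTorsion (W.baseChange E) ((p ^ k : ℕ) : ℤ) :=
    ⟨T P₀, (mem_torsionPoints_iff _ _ _).mpr hP₀tor⟩ with hP₀'def
  have hQtor : ((p ^ k : ℕ) : ℤ) • (T Q) = 0 := by rw [← map_zsmul, hQ, map_zero]
  set Q' : geomTorsion (W.baseChange E) ((p ^ k : ℕ) : ℤ) :=
    ⟨T Q, (mem_torsionPoints_iff _ _ _).mpr hQtor⟩ with hQ'def
  -- bilinearity consequences
  have he0 : ∀ S', e 0 S' = 1 := fun S' ↦ by
    have h := haddl 0 0 S'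
    rw [add_zero] at h
    have hne : e 0 S' ≠ 0 := fun h0 ↦ by
      have := hpow 0 S'; rw [h0, zero_pow hpk0] at this
      exact zero_ne_one this
    exact (mul_right_eq_self₀.mp h.symm).resolve_right hne
  have hnsmul_left : ∀ (n : ℕ) (S₁ S₂ : geomTorsion (W.baseChange E) ((p ^ k : ℕ) : ℤ)),
      e (n • S₁) S₂ = e S₁ S₂ ^ n := by
    intro n S₁ S₂
    induction n with
    | zero => rw [zero_smul, pow_zero, he0]
    | succ n ih => rw [add_smul, one_smul, haddl, ih, pow_succ]
  have he0r : ∀ S', e S' 0 = 1 := fun S' ↦ by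
    have h := haddr S' 0 0
    rw [add_zero] at h
    have hne : e S' 0 ≠ 0 := fun h0 ↦ by
      have := hpow S' 0; rw [h0, zero_pow hpk0] at this
      exact zero_ne_one this
    exact (mul_right_eq_self₀.mp h.symm).resolve_right hne
  have hnsmul_right : ∀ (n : ℕ) (S₁ S₂ : geomTorsion (W.baseChange E) ((p ^ k : ℕ) : ℤ)),
      e S₁ (n • S₂) = e S₁ S₂ ^ n := by
    intro n S₁ S₂
    induction n with
    | zero => rw [zero_smul, pow_zero, he0r]
    | succ n ih => rw [add_smul, one_smul, haddr, ih, pow_succ]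
  have hneg_left : ∀ (S₁ S₂ : geomTorsion (W.baseChange E) ((p ^ k : ℕ) : ℤ)),
      e (-S₁) S₂ = (e S₁ S₂)⁻¹ := by
    intro S₁ S₂
    have h := haddl (-S₁) S₁ S₂
    rw [neg_add_cancel, he0] at h
    exact eq_inv_of_mul_eq_one_left h.symm
  have hne1 : ∀ S₁ S₂, e S₁ S₂ ≠ 0 := fun S₁ S₂ h0 ↦ by
    have := hpow S₁ S₂; rw [h0, zero_pow hpk0] at this; exact zero_ne_one this
  -- the annihilator `K₀ = {R | e(R, P₀) = 1}` of `P₀`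
  let K₀ : AddSubgroup (geomTorsion (W.baseChange E) ((p ^ k : ℕ) : ℤ)) :=
    { carrier := {R | e R P₀' = 1}
      zero_mem' := he0 P₀'
      add_mem' := fun {R₁ R₂} h₁ h₂ ↦ by
        simp only [Set.mem_setOf_eq] at h₁ h₂ ⊢
        rw [haddl, h₁, h₂, mul_one]
      neg_mem' := fun {R} h ↦ by
        simp only [Set.mem_setOf_eq] at h ⊢
        rw [hneg_left, h, inv_one] }
  have hmemK₀ : ∀ R, R ∈ K₀ ↔ e R P₀' = 1 := fun R ↦ Iff.rfl
  -- `ℤ P₀ ≤ K₀`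
  have hzle : AddSubgroup.zmultiples P₀' ≤ K₀ := by
    rw [AddSubgroup.zmultiples_le, hmemK₀, hself]
  -- finiteness and cardinalities: `#E[p^k] = p^{2k}`, `#ℤP₀ = p^k`
  haveI : IsAlgClosed (AlgebraicClosure E) := inferInstance
  have hcardT : Nat.card (geomTorsion (W.baseChange E) ((p ^ k : ℕ) : ℤ)) = (p ^ k) ^ 2 :=
    card_torsionBy_eq_sq (E := (W.baseChange E).baseChange (AlgebraicClosure E)) (n := p ^ k)
      (by exact_mod_cast hpk0)
  haveI hfinT : Finite (geomTorsion (W.baseChange E) ((p ^ k : ℕ) : ℤ)) :=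
    Nat.finite_of_card_ne_zero (by rw [hcardT]; positivity)
  have hordP₀' : addOrderOf P₀' = p ^ k := by
    have h1 : addOrderOf (P₀' : geomPoints (W.baseChange E)) = addOrderOf P₀' :=
      addOrderOf_injective (geomTorsion (W.baseChange E) ((p ^ k : ℕ) : ℤ)).subtype
        Subtype.coe_injective P₀'
    rw [← h1]
    change addOrderOf (T P₀) = p ^ k
    rw [← hP₀]
    exact addOrderOf_injective T.toAddMonoidHom T.injective P₀
  have hcardZ : Nat.card (AddSubgroup.zmultiples P₀') = p ^ k := by
    rw [Nat.card_zmultiples, hordP₀']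
  -- a partner `Q''` with `e(Q'', P₀)` of exact order `p^k` (as in the cyclotomic-line lemma)
  obtain ⟨Q'', hQ''⟩ : ∃ Q'' : geomTorsion (W.baseChange E) ((p ^ k : ℕ) : ℤ),
      e Q'' P₀' ^ p ^ (k - 1) ≠ 1 := by
    by_contra hall
    push Not at hall
    have h0 : (p ^ (k - 1)) • P₀' = 0 := by
      refine hnondeg _ fun S' ↦ ?_
      rw [hnsmul_right, hall]
    have hdvd : p ^ k ∣ p ^ (k - 1) := by
      rw [← hordP₀']; exact addOrderOf_dvd_of_nsmul_eq_zero h0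
    exact absurd (Nat.le_of_dvd (pow_pos hp.out.pos _) hdvd)
      (not_le.mpr (Nat.pow_lt_pow_right hp.out.one_lt (Nat.sub_lt hk one_pos)))
  set ζ₀ := e Q'' P₀' with hζ₀def
  have hζ₀prim : IsPrimitiveRoot ζ₀ (p ^ k) := by
    have hζpow : ζ₀ ^ p ^ k = 1 := hpow Q'' P₀'
    have hdvd : orderOf ζ₀ ∣ p ^ k := orderOf_dvd_of_pow_eq_one hζpow
    obtain ⟨i, hi, hci⟩ := (Nat.dvd_prime_pow hp.out).mp hdvd
    have hik : i = k := by
      by_contra hne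
      have hlt : i ≤ k - 1 := Nat.le_sub_one_of_lt (lt_of_le_of_ne hi hne)
      apply hQ''
      have : orderOf ζ₀ ∣ p ^ (k - 1) := hci ▸ pow_dvd_pow p hlt
      exact orderOf_dvd_iff_pow_eq_one.mp this
    have h := IsPrimitiveRoot.orderOf ζ₀
    rwa [hci, hik] at h
  -- the quotient `E[p^k]/K₀` has at least `p^k` elements: `j Q''`, `j < p^k`, are pairwise
  -- incongruent modulo `K₀`
  haveI : Finite K₀ := inferInstance
  have hquot : p ^ k ≤ Nat.card (geomTorsion (W.baseChange E) ((p ^ k : ℕ) : ℤ) ⧸ K₀) := by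
    let ι : Fin (p ^ k) → geomTorsion (W.baseChange E) ((p ^ k : ℕ) : ℤ) ⧸ K₀ :=
      fun j ↦ QuotientAddGroup.mk ((j : ℕ) • Q'')
    have hι : Function.Injective ι := by
      intro j₁ j₂ h
      have hmem : (j₁ : ℕ) • Q'' - (j₂ : ℕ) • Q'' ∈ K₀ := by
        rw [← QuotientAddGroup.eq_iff_sub_mem]; exact h
      -- `e(j₁ Q'' - j₂ Q'', P₀) = ζ₀^{j₁} ζ₀^{-j₂} = 1 ⇒ j₁ = j₂`
      rw [hmemK₀, sub_eq_add_neg, haddl, hneg_left, hnsmul_left, hnsmul_left] at hmem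
      have heq : ζ₀ ^ (j₁ : ℕ) = ζ₀ ^ (j₂ : ℕ) := by
        rw [← mul_inv_eq_one₀ (pow_ne_zero _ (hne1 _ _))]; exact hmem
      exact Fin.ext (hζ₀prim.pow_inj j₁.2 j₂.2 heq)
    haveI : Finite (geomTorsion (W.baseChange E) ((p ^ k : ℕ) : ℤ) ⧸ K₀) := inferInstance
    have h := Nat.card_le_card_of_injective ι hι
    rwa [Nat.card_eq_fintype_card, Fintype.card_fin] at h
  -- hence `#K₀ ≤ p^k` and `K₀ = ℤP₀`
  have hmul : Nat.card (geomTorsion (W.baseChange E) ((p ^ k : ℕ) : ℤ)) =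
      Nat.card (geomTorsion (W.baseChange E) ((p ^ k : ℕ) : ℤ) ⧸ K₀) * Nat.card K₀ :=
    AddSubgroup.card_eq_card_quotient_mul_card_addSubgroup K₀
  have hK₀le : Nat.card K₀ ≤ p ^ k := by
    by_contra hlt
    push Not at hlt
    have h1 : p ^ k * p ^ k < Nat.card (geomTorsion (W.baseChange E) ((p ^ k : ℕ) : ℤ) ⧸ K₀) *
        Nat.card K₀ := Nat.mul_lt_mul_of_le_of_lt hquot hlt (Nat.pos_of_ne_zero (by
          intro h0; rw [h0] at hquot; exact absurd hquot (not_le.mpr (pow_pos hp.out.pos k))))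
    rw [← hmul, hcardT, sq] at h1
    exact lt_irrefl _ h1
  have hK₀eq : AddSubgroup.zmultiples P₀' = K₀ :=
    AddSubgroup.eq_of_le_of_card_ge hzle (by rw [hcardZ]; exact hK₀le)
  -- the element `b σQ - Q` lies in `K₀`
  have hσP₀' : σ • P₀' = b • P₀' := by
    apply Subtype.ext
    rw [AddSubgroup.torsionBy.coe_smul, AddSubmonoidClass.coe_nsmul]
    change σ • T P₀ = b • T P₀
    rw [← hT, hσP₀, map_nsmul]
  have hmem : b • (σ • Q') - Q' ∈ K₀ := by
    rw [hmemK₀, sub_eq_add_neg, haddl, hneg_left, hnsmul_left, ← hnsmul_right, ← hσP₀', ← hgal,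
      hσμ _ (hpow Q' P₀'), mul_inv_cancel₀ (hne1 _ _)]
  rw [← hK₀eq, AddSubgroup.mem_zmultiples_iff] at hmem
  obtain ⟨m, hm⟩ := hmem
  -- back to `E(K̄_E)` and to a natural number
  have hm' : m • P₀ = b • σ • Q - Q := by
    apply T.injective
    have h := congrArg (fun R : geomTorsion (W.baseChange E) ((p ^ k : ℕ) : ℤ) ↦
      (R : geomPoints (W.baseChange E))) hm
    simp only [AddSubgroup.coe_sub, AddSubgroup.torsionBy.coe_smul] at h
    change m • T P₀ = b • σ • T Q - T Q at h
    rw [map_zsmul, map_sub, map_nsmul, hT]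
    exact h
  have hpkP₀ : ((p ^ k : ℕ) : ℤ) • P₀ = 0 := by
    rw [natCast_zsmul, ← hP₀, addOrderOf_nsmul_eq_zero]
  refine ⟨(m % ((p ^ k : ℕ) : ℤ)).toNat, ?_⟩
  rw [← hm', ← natCast_zsmul, Int.toNat_of_nonneg (Int.emod_nonneg _ (by exact_mod_cast hpk0)),
    Int.emod_def, sub_smul, mul_comm, mul_smul, hpkP₀, smul_zero, sub_zero]

end WeierstrassCurve
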